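import Summits.NavierStokesRegularity.NavierStokesRegularity.Theorems.FilamentSkeletonRssCoreLinearInvertibilityGradientInClassTools
import Literature.Analysis.FluidPDE.GaussianVortexKernelRadial
import Literature.Analysis.FluidPDE.BurgersPhiTemperate
import Literature.Analysis.FluidPDE.WholeSpaceIBP
import Summits.AnomalousDissipation.AnomalousDissipation.Theorems.MarginalStabilityChainStretchedVortexRowsStubCellSolvabilityRadialWeights
import Summits.AnomalousDissipation.AnomalousDissipation.Theorems.MarginalStabilityChainStretchedVortexRowsStubCoreInverseIntegrabilityTools

/-!
# Crux `CoreLinearInvertibility` (stmt-NavierStokesRegularity-17973), line `Sketch`: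
# tools for stub `stub_oddSymmetrizerBounds` — the kernel weight `Φ(|x|)` and second-order classes

Helper file (theorems only; lands `--supports stmt-NavierStokesRegularity-17973`, ends with the
registered sub-stub `stub_oddSymmetrizerBoundsToolsB`) for the stub `stub_oddSymmetrizerBounds` of
the skeleton `Cruxes/CoreLinearInvertibility/Lines/Sketch.lean` (Maekawa's forward symmetrizer
`u = Φ(|x|) ψ`, `Φ = kerWeight = G/(2Ω) = 4πG/φ(|x|²/4)`, `φ = burgersPhi`).  Second-order
bookkeeping ("value, gradient and Hessian are bounded by …"):

* the Leibniz package `|fv|, ‖D(fv)‖, ‖D²(fv)‖ ≤ 4ab` from `|f|, ‖Df‖, ‖D²f‖ ≤ a` and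
  `|v|, ‖Dv‖, ‖D²v‖ ≤ b` (`oddSym_mul_bounds`), and `|L_λ f(x)| ≤ 3(1 + |x|) a` for `|λ| ≤ 1`
  (`oddSym_abs_strainedVorticityOperator_le`; `L_λ = strainedVorticityOperator`);
* the Gaussian `G`: `|G|, ‖DG‖, ‖D²G‖ ≤ (1 + |x|)² G` (`oddSym_gauss_bounds`); the smooth radial
  factor `1/φ(|x|²/4)` has temperate growth (tree `hasTemperateGrowth_inv_burgersPhi`), hence
  polynomial second-order bounds (`oddSym_invPhi_bounds`);
* the kernel weight `x ↦ Φ(|x|) = kerWeight ‖x‖` is smooth, of second-order Gaussian class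
  `C (1 + |x|)^N e^{−|x|²/4}` (`oddSym_theta_bounds`), its derivative is radial
  (`oddSym_fderiv_theta_eq_zero`), and `Φ Ω = G/2` with `Ω = (8π)⁻¹ φ(|x|²/4)` (`v^G = Ω x^⊥`);
* `G_λ⁻¹ X² ∈ L¹` for every measurable `X` of Gaussian class (`λ ∈ [0,1)`).

References: Y. Maekawa, J. Math. Fluid Mech. 13 (2011) §2 (= Th. Gallay, Y. Maekawa,
arXiv:1610.08384, Lemma 2.7: the weight `Φ = G/(2Ω)`); Th. Gallay, C. E. Wayne, J. Math. Fluid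
Mech. 9 (2007), proof of Prop. 3.1; folklore calculus.
-/

set_option linter.dupNamespace false

noncomputable section

namespace Summit.NavierStokesRegularity.NavierStokesRegularity.Theorems

open MeasureTheory Filter Topology Set Function Metric
open Literature.Analysis.FluidPDE
open Summit.AnomalousDissipation.AnomalousDissipation.Theorems.MarginalStabilityChainStretchedVortexRows
open scoped InnerProductSpace Laplacian ContDiff

/-! ### Second-order Leibniz bookkeeping -/

/-- **Leibniz at second order**: if `|f|, ‖Df‖, ‖D²f‖ ≤ a` and `|v|, ‖Dv‖, ‖D²v‖ ≤ b` pointwise,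
then `|fv|, ‖D(fv)‖, ‖D²(fv)‖ ≤ 4ab` (`D(fv) = fDv + vDf`,
`D²(fv) = fD²v + Df ⊗ Dv + vD²f + Dv ⊗ Df`). [folklore] -/
theorem oddSym_mul_bounds {f v a b : EuclideanSpace ℝ (Fin 2) → ℝ} (hf : ContDiff ℝ 2 f)
    (hv : ContDiff ℝ 2 v)
    (hfa : ∀ x, |f x| ≤ a x ∧ ‖fderiv ℝ f x‖ ≤ a x ∧ ‖fderiv ℝ (fderiv ℝ f) x‖ ≤ a x)
    (hvb : ∀ x, |v x| ≤ b x ∧ ‖fderiv ℝ v x‖ ≤ b x ∧ ‖fderiv ℝ (fderiv ℝ v) x‖ ≤ b x)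
    (x : EuclideanSpace ℝ (Fin 2)) :
    |f x * v x| ≤ 4 * (a x * b x) ∧ ‖fderiv ℝ (fun y => f y * v y) x‖ ≤ 4 * (a x * b x) ∧
      ‖fderiv ℝ (fderiv ℝ (fun y => f y * v y)) x‖ ≤ 4 * (a x * b x) := by
  obtain ⟨hf0, hf1, hf2⟩ := hfa x
  obtain ⟨hv0, hv1, hv2⟩ := hvb x
  have ha : 0 ≤ a x := (abs_nonneg _).trans hf0
  have hb : 0 ≤ b x := (abs_nonneg _).trans hv0
  have hab : 0 ≤ a x * b x := mul_nonneg ha hb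
  have hfd : Differentiable ℝ f := hf.differentiable two_ne_zero
  have hvd : Differentiable ℝ v := hv.differentiable two_ne_zero
  have hD : fderiv ℝ (fun y => f y * v y) = fun x => f x • fderiv ℝ v x + v x • fderiv ℝ f x :=
    funext fun x => fderiv_fun_mul (hfd x) (hvd x)
  refine ⟨?_, ?_, ?_⟩
  · rw [abs_mul]
    nlinarith [mul_le_mul hf0 hv0 (abs_nonneg _) ha]
  · rw [hD]
    calc ‖f x • fderiv ℝ v x + v x • fderiv ℝ f x‖
        ≤ |f x| * ‖fderiv ℝ v x‖ + |v x| * ‖fderiv ℝ f x‖ := by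
          refine (norm_add_le _ _).trans (le_of_eq ?_)
          rw [norm_smul, norm_smul, Real.norm_eq_abs, Real.norm_eq_abs]
      _ ≤ a x * b x + b x * a x :=
          add_le_add (mul_le_mul hf0 hv1 (norm_nonneg _) ha) (mul_le_mul hv0 hf1 (norm_nonneg _) hb)
      _ ≤ 4 * (a x * b x) := by nlinarith
  · rw [hD]
    have hdf' : DifferentiableAt ℝ (fderiv ℝ f) x :=
      ((hf.fderiv_right (m := 1) le_rfl).differentiable one_ne_zero) x
    have hdv' : DifferentiableAt ℝ (fderiv ℝ v) x :=
      ((hv.fderiv_right (m := 1) le_rfl).differentiable one_ne_zero) x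
    rw [fderiv_fun_add ((hfd x).fun_smul hdv') ((hvd x).fun_smul hdf'), fderiv_fun_smul (hfd x) hdv',
      fderiv_fun_smul (hvd x) hdf']
    have e1 : ‖f x • fderiv ℝ (fderiv ℝ v) x‖ ≤ a x * b x := by
      refine (ContinuousLinearMap.opNorm_smul_le _ _).trans ?_
      rw [Real.norm_eq_abs]
      exact mul_le_mul hf0 hv2 (norm_nonneg (fderiv ℝ (fderiv ℝ v) x)) ha
    have e2 : ‖(fderiv ℝ f x).smulRight (fderiv ℝ v x)‖ ≤ a x * b x := by
      rw [ContinuousLinearMap.norm_smulRight_apply]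
      exact mul_le_mul hf1 hv1 (norm_nonneg (fderiv ℝ v x)) ha
    have e3 : ‖v x • fderiv ℝ (fderiv ℝ f) x‖ ≤ b x * a x := by
      refine (ContinuousLinearMap.opNorm_smul_le _ _).trans ?_
      rw [Real.norm_eq_abs]
      exact mul_le_mul hv0 hf2 (norm_nonneg (fderiv ℝ (fderiv ℝ f) x)) hb
    have e4 : ‖(fderiv ℝ v x).smulRight (fderiv ℝ f x)‖ ≤ b x * a x := by
      rw [ContinuousLinearMap.norm_smulRight_apply]
      exact mul_le_mul hv1 hf1 (norm_nonneg (fderiv ℝ f x)) hb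
    refine ((ContinuousLinearMap.opNorm_add_le _ _).trans (add_le_add
      ((ContinuousLinearMap.opNorm_add_le _ _).trans (add_le_add e1 e2))
      ((ContinuousLinearMap.opNorm_add_le _ _).trans (add_le_add e3 e4)))).trans (le_of_eq ?_)
    ring

/-- Constant multiples scale the second-order package: `|cf|, ‖D(cf)‖, ‖D²(cf)‖ ≤ |c| a`. [folklore] -/
theorem oddSym_const_mul_bounds {f a : EuclideanSpace ℝ (Fin 2) → ℝ} (hf : ContDiff ℝ 2 f) (c : ℝ)
    (hfa : ∀ x, |f x| ≤ a x ∧ ‖fderiv ℝ f x‖ ≤ a x ∧ ‖fderiv ℝ (fderiv ℝ f) x‖ ≤ a x)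
    (x : EuclideanSpace ℝ (Fin 2)) :
    |c * f x| ≤ |c| * a x ∧ ‖fderiv ℝ (fun y => c * f y) x‖ ≤ |c| * a x ∧
      ‖fderiv ℝ (fderiv ℝ (fun y => c * f y)) x‖ ≤ |c| * a x := by
  obtain ⟨hf0, hf1, hf2⟩ := hfa x
  have hfd : Differentiable ℝ f := hf.differentiable two_ne_zero
  have hD : fderiv ℝ (fun y => c * f y) = fun x => c • fderiv ℝ f x :=
    funext fun x => fderiv_const_mul (hfd x) c
  have hdf' : DifferentiableAt ℝ (fderiv ℝ f) x :=
    ((hf.fderiv_right (m := 1) le_rfl).differentiable one_ne_zero) x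
  refine ⟨?_, ?_, ?_⟩
  · rw [abs_mul]; exact mul_le_mul_of_nonneg_left hf0 (abs_nonneg c)
  · rw [hD, norm_smul, Real.norm_eq_abs]; exact mul_le_mul_of_nonneg_left hf1 (abs_nonneg c)
  · rw [hD, fderiv_fun_const_smul hdf']
    refine (ContinuousLinearMap.opNorm_smul_le _ _).trans ?_
    rw [Real.norm_eq_abs]
    exact mul_le_mul_of_nonneg_left hf2 (abs_nonneg c)

/-- `|D²f(x)[e, e]| ≤ ‖D²f(x)‖` for a unit coordinate vector `e`. [folklore] -/
theorem oddSym_abs_fderiv_fderiv_single_le (f : EuclideanSpace ℝ (Fin 2) → ℝ)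
    (x : EuclideanSpace ℝ (Fin 2)) (i : Fin 2) :
    |fderiv ℝ (fderiv ℝ f) x (EuclideanSpace.single i 1) (EuclideanSpace.single i 1)| ≤
      ‖fderiv ℝ (fderiv ℝ f) x‖ := by
  have h1 : ‖(EuclideanSpace.single i (1 : ℝ) : EuclideanSpace ℝ (Fin 2))‖ = 1 := by simp
  rw [← Real.norm_eq_abs]
  calc ‖fderiv ℝ (fderiv ℝ f) x (EuclideanSpace.single i 1) (EuclideanSpace.single i 1)‖
      ≤ ‖fderiv ℝ (fderiv ℝ f) x (EuclideanSpace.single i 1)‖ * ‖(EuclideanSpace.single i (1 : ℝ) :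
          EuclideanSpace ℝ (Fin 2))‖ := ContinuousLinearMap.le_opNorm _ _
    _ ≤ ‖fderiv ℝ (fderiv ℝ f) x‖ * ‖(EuclideanSpace.single i (1 : ℝ) : EuclideanSpace ℝ (Fin 2))‖ *
          ‖(EuclideanSpace.single i (1 : ℝ) : EuclideanSpace ℝ (Fin 2))‖ :=
        mul_le_mul_of_nonneg_right (ContinuousLinearMap.le_opNorm _ _) (norm_nonneg _)
    _ = ‖fderiv ℝ (fderiv ℝ f) x‖ := by rw [h1, mul_one, mul_one]

/-- `|Δ f(x)| ≤ 2 ‖D²f(x)‖` on `ℝ²`. [folklore] -/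
theorem oddSym_abs_laplacian_le (f : EuclideanSpace ℝ (Fin 2) → ℝ) (x : EuclideanSpace ℝ (Fin 2)) :
    |Δ f x| ≤ 2 * ‖fderiv ℝ (fderiv ℝ f) x‖ := by
  rw [InnerProductSpace.laplacian_eq_iteratedFDeriv_orthonormalBasis f (EuclideanSpace.basisFun (Fin 2) ℝ)]
  simp only [Fin.sum_univ_two, iteratedFDeriv_two_apply, EuclideanSpace.basisFun_apply,
    Matrix.cons_val_zero, Matrix.cons_val_one]
  have h0 := oddSym_abs_fderiv_fderiv_single_le f x 0
  have h1 := oddSym_abs_fderiv_fderiv_single_le f x 1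
  exact (abs_add_le _ _).trans (by linarith)

/-- **`|L_λ f(x)| ≤ 3 (1 + |x|) a`** when `|f(x)|, ‖Df(x)‖, ‖D²f(x)‖ ≤ a` and `|λ| ≤ 1`
(`|Δf| ≤ 2‖D²f‖`, `|xᵢ ∂ᵢf| ≤ |x| ‖Df‖`, `0 ≤ (1 ± λ)/2 ≤ 1`). [folklore] -/
theorem oddSym_abs_strainedVorticityOperator_le {f : EuclideanSpace ℝ (Fin 2) → ℝ} {a lam : ℝ}
    {x : EuclideanSpace ℝ (Fin 2)} (hlam : |lam| ≤ 1) (h0 : |f x| ≤ a) (h1 : ‖fderiv ℝ f x‖ ≤ a)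
    (h2 : ‖fderiv ℝ (fderiv ℝ f) x‖ ≤ a) :
    |strainedVorticityOperator lam f x| ≤ 3 * (1 + ‖x‖) * a := by
  have ha : 0 ≤ a := (abs_nonneg _).trans h0
  have hΔ := oddSym_abs_laplacian_le f x
  have hD : ∀ i : Fin 2, |x i * fderiv ℝ f x (EuclideanSpace.single i 1)| ≤ ‖x‖ * a := fun i => by
    rw [abs_mul]
    refine mul_le_mul (FourierNS.abs_apply_le_norm x i) ?_ (abs_nonneg _) (norm_nonneg _)
    rw [← Real.norm_eq_abs]
    refine (ContinuousLinearMap.le_opNorm _ _).trans ?_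
    have hn : ‖(EuclideanSpace.single i (1 : ℝ) : EuclideanSpace ℝ (Fin 2))‖ = 1 := by simp
    rw [hn, mul_one]
    exact h1
  have hl1 : |(1 + lam) / 2| ≤ 1 := by
    rw [abs_le] at hlam ⊢; constructor <;> linarith [hlam.1, hlam.2]
  have hl2 : |(1 - lam) / 2| ≤ 1 := by
    rw [abs_le] at hlam ⊢; constructor <;> linarith [hlam.1, hlam.2]
  have e1 : |(1 + lam) / 2 * x 0 * fderiv ℝ f x (EuclideanSpace.single 0 1)| ≤ ‖x‖ * a := by
    rw [mul_assoc, abs_mul]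
    exact (mul_le_mul hl1 (hD 0) (abs_nonneg _) zero_le_one).trans (by rw [one_mul])
  have e2 : |(1 - lam) / 2 * x 1 * fderiv ℝ f x (EuclideanSpace.single 1 1)| ≤ ‖x‖ * a := by
    rw [mul_assoc, abs_mul]
    exact (mul_le_mul hl2 (hD 1) (abs_nonneg _) zero_le_one).trans (by rw [one_mul])
  unfold strainedVorticityOperator
  calc |Δ f x + (1 + lam) / 2 * x 0 * fderiv ℝ f x (EuclideanSpace.single 0 1) +
        (1 - lam) / 2 * x 1 * fderiv ℝ f x (EuclideanSpace.single 1 1) + f x|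
      ≤ |Δ f x| + |(1 + lam) / 2 * x 0 * fderiv ℝ f x (EuclideanSpace.single 0 1)| +
        |(1 - lam) / 2 * x 1 * fderiv ℝ f x (EuclideanSpace.single 1 1)| + |f x| := by
        refine (abs_add_le _ _).trans (add_le_add ((abs_add_le _ _).trans (add_le_add
          (abs_add_le _ _) le_rfl)) le_rfl)
    _ ≤ 2 * a + ‖x‖ * a + ‖x‖ * a + a := by linarith [hΔ, e1, e2, h0, h2]
    _ ≤ 3 * (1 + ‖x‖) * a := by nlinarith [norm_nonneg x]

/-! ### The Gaussian and the radial factor `1/φ(|x|²/4)` -/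

/-- `‖⟪·, ·⟫‖ ≤ 1` for the inner product as a bilinear map. [folklore] -/
theorem oddSym_norm_innerSL_le :
    ‖(innerSL ℝ : EuclideanSpace ℝ (Fin 2) →L[ℝ] EuclideanSpace ℝ (Fin 2) →L[ℝ] ℝ)‖ ≤ 1 :=
  ContinuousLinearMap.opNorm_le_bound _ zero_le_one fun v => by rw [innerSL_apply_norm, one_mul]

/-- `DG = −(G/2) ⟪x, ·⟫` as a continuous linear map. [folklore] -/
theorem oddSym_fderiv_gauss_eq :
    fderiv ℝ gaussVortexProfile = fun x : EuclideanSpace ℝ (Fin 2) =>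
      ((-(1 / 2 : ℝ)) * gaussVortexProfile x) • innerSL ℝ x := by
  funext x
  ext v
  rw [fderiv_gaussVortexProfile_apply, FunLike.coe_smul, Pi.smul_apply, innerSL_apply_apply,
    smul_eq_mul]
  ring

/-- **Second-order Gaussian class of `G`**: `|G|, ‖DG‖, ‖D²G‖ ≤ (1 + |x|)² G`
(`DG = −(G/2)x`, `D²G = −(G/2) I + (G/4) x ⊗ x`). [folklore] -/
theorem oddSym_gauss_bounds (x : EuclideanSpace ℝ (Fin 2)) :
    |gaussVortexProfile x| ≤ (1 + ‖x‖) ^ 2 * gaussVortexProfile x ∧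
    ‖fderiv ℝ gaussVortexProfile x‖ ≤ (1 + ‖x‖) ^ 2 * gaussVortexProfile x ∧
    ‖fderiv ℝ (fderiv ℝ gaussVortexProfile) x‖ ≤ (1 + ‖x‖) ^ 2 * gaussVortexProfile x := by
  have hG := gaussVortexProfile_pos x
  have hr := norm_nonneg x
  have hDG := norm_fderiv_gaussVortexProfile_le x
  have hrG : 0 ≤ ‖x‖ * gaussVortexProfile x := mul_nonneg hr hG.le
  have hrrG : 0 ≤ ‖x‖ * ‖x‖ * gaussVortexProfile x := mul_nonneg (mul_nonneg hr hr) hG.le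
  have hsq : (1 + ‖x‖) ^ 2 * gaussVortexProfile x =
      gaussVortexProfile x + 2 * (‖x‖ * gaussVortexProfile x) + ‖x‖ * ‖x‖ * gaussVortexProfile x := by ring
  refine ⟨?_, ?_, ?_⟩
  · rw [abs_of_pos hG, hsq]; nlinarith
  · rw [hsq]; nlinarith
  · rw [oddSym_fderiv_gauss_eq]
    have hc : DifferentiableAt ℝ (fun y : EuclideanSpace ℝ (Fin 2) => (-(1 / 2 : ℝ)) * gaussVortexProfile y) x :=
      ((contDiff_gaussVortexProfile (n := 1)).differentiable one_ne_zero x).const_mul _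
    have hi : DifferentiableAt ℝ (fun y : EuclideanSpace ℝ (Fin 2) => innerSL ℝ y) x :=
      (innerSL ℝ).differentiableAt
    have hI : ‖fderiv ℝ (fun y : EuclideanSpace ℝ (Fin 2) => innerSL ℝ y) x‖ ≤ 1 := by
      rw [ContinuousLinearMap.fderiv]; exact oddSym_norm_innerSL_le
    rw [fderiv_fun_smul hc hi, fderiv_const_mul ((contDiff_gaussVortexProfile (n := 1)).differentiable one_ne_zero x)]
    have e1 : ‖(-(1 / 2 : ℝ) * gaussVortexProfile x) • fderiv ℝ (fun y : EuclideanSpace ℝ (Fin 2) => innerSL ℝ y) x‖ ≤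
        gaussVortexProfile x / 2 := by
      refine (ContinuousLinearMap.opNorm_smul_le _ _).trans ?_
      rw [Real.norm_eq_abs, abs_mul, abs_neg, abs_of_pos (by norm_num : (0:ℝ) < 1 / 2),
        abs_of_pos hG]
      calc 1 / 2 * gaussVortexProfile x * ‖fderiv ℝ (fun y : EuclideanSpace ℝ (Fin 2) => innerSL ℝ y) x‖
          ≤ 1 / 2 * gaussVortexProfile x * 1 := mul_le_mul_of_nonneg_left hI (by positivity)
        _ = gaussVortexProfile x / 2 := by ring
    have e2 : ‖((-(1 / 2 : ℝ)) • fderiv ℝ gaussVortexProfile x).smulRight (innerSL ℝ x)‖ ≤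
        gaussVortexProfile x / 2 * ‖x‖ * ‖x‖ / 2 := by
      rw [ContinuousLinearMap.norm_smulRight_apply, norm_smul, Real.norm_eq_abs, innerSL_apply_norm,
        abs_neg, abs_of_pos (by norm_num : (0:ℝ) < 1 / 2)]
      calc 1 / 2 * ‖fderiv ℝ gaussVortexProfile x‖ * ‖x‖ ≤ 1 / 2 * (gaussVortexProfile x / 2 * ‖x‖) * ‖x‖ := by
            gcongr
        _ = gaussVortexProfile x / 2 * ‖x‖ * ‖x‖ / 2 := by ring
    refine ((ContinuousLinearMap.opNorm_add_le _ _).trans (add_le_add e1 e2)).trans ?_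
    rw [hsq]
    nlinarith

/-- `1/φ(|x|²/4)` has temperate growth (tree: `1/φ` has temperate growth on `ℝ`). [folklore] -/
theorem oddSym_hasTemperateGrowth_invPhi :
    Function.HasTemperateGrowth (fun x : EuclideanSpace ℝ (Fin 2) => (burgersPhi (‖x‖ ^ 2 / 4))⁻¹) := by
  have h2 : Function.HasTemperateGrowth (fun x : EuclideanSpace ℝ (Fin 2) => ‖x‖ ^ 2 / 4) := by
    have : (fun x : EuclideanSpace ℝ (Fin 2) => ‖x‖ ^ 2 / 4) = fun x => ‖x‖ ^ 2 * (1 / 4) := by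
      funext x; ring
    rw [this]
    fun_prop
  exact hasTemperateGrowth_inv_burgersPhi.comp h2

/-- **Polynomial second-order bounds for `1/φ(|x|²/4)`**. [folklore] -/
theorem oddSym_invPhi_bounds : ∃ (C : ℝ) (k : ℕ), 0 ≤ C ∧ ∀ x : EuclideanSpace ℝ (Fin 2),
    |(burgersPhi (‖x‖ ^ 2 / 4))⁻¹| ≤ C * (1 + ‖x‖) ^ k ∧
    ‖fderiv ℝ (fun y : EuclideanSpace ℝ (Fin 2) => (burgersPhi (‖y‖ ^ 2 / 4))⁻¹) x‖ ≤ C * (1 + ‖x‖) ^ k ∧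
    ‖fderiv ℝ (fderiv ℝ (fun y : EuclideanSpace ℝ (Fin 2) => (burgersPhi (‖y‖ ^ 2 / 4))⁻¹)) x‖ ≤
      C * (1 + ‖x‖) ^ k := by
  obtain ⟨k, C, hC, h⟩ := oddSym_hasTemperateGrowth_invPhi.norm_iteratedFDeriv_le_uniform 2
  refine ⟨C, k, hC, fun x => ⟨?_, ?_, ?_⟩⟩
  · have := h 0 (by norm_num) x
    rwa [norm_iteratedFDeriv_zero, Real.norm_eq_abs] at this
  · have := h 1 (by norm_num) x
    rwa [norm_iteratedFDeriv_one] at this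
  · have := h 2 le_rfl x
    rwa [← norm_iteratedFDeriv_fderiv, norm_iteratedFDeriv_one] at this

/-! ### The kernel weight `Φ(|x|) = kerWeight ‖x‖ = 4πG/φ(|x|²/4)` -/

/-- `x ↦ Φ(|x|)` written through `G` and `1/φ`. [folklore] -/
theorem oddSym_theta_eq : (fun x : EuclideanSpace ℝ (Fin 2) => kerWeight ‖x‖) =
    fun x => (4 * Real.pi * gaussVortexProfile x) * (burgersPhi (‖x‖ ^ 2 / 4))⁻¹ :=
  funext fun x => by rw [kerWeight_norm_eq, div_eq_mul_inv]

/-- `x ↦ Φ(|x|)` is smooth. [folklore] -/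
theorem oddSym_theta_contDiff {n : WithTop ℕ∞} :
    ContDiff ℝ n (fun x : EuclideanSpace ℝ (Fin 2) => kerWeight ‖x‖) := by
  rw [show (fun x : EuclideanSpace ℝ (Fin 2) => kerWeight ‖x‖) =
      fun x => 4 * Real.pi * gaussVortexProfile x / burgersPhi (‖x‖ ^ 2 / 4) from funext kerWeight_norm_eq]
  exact contDiff_cellPotential

/-- **Second-order Gaussian class of the kernel weight**:
`|Φ|, ‖DΦ(|·|)‖, ‖D²Φ(|·|)‖ ≤ C (1 + |x|)^N e^{−|x|²/4}`. [folklore] -/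
theorem oddSym_theta_bounds : ∃ (C : ℝ) (N : ℕ), 0 ≤ C ∧ ∀ x : EuclideanSpace ℝ (Fin 2),
    |kerWeight ‖x‖| ≤ C * (1 + ‖x‖) ^ N * Real.exp (-(‖x‖ ^ 2 / 4)) ∧
    ‖fderiv ℝ (fun y : EuclideanSpace ℝ (Fin 2) => kerWeight ‖y‖) x‖ ≤
      C * (1 + ‖x‖) ^ N * Real.exp (-(‖x‖ ^ 2 / 4)) ∧
    ‖fderiv ℝ (fderiv ℝ (fun y : EuclideanSpace ℝ (Fin 2) => kerWeight ‖y‖)) x‖ ≤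
      C * (1 + ‖x‖) ^ N * Real.exp (-(‖x‖ ^ 2 / 4)) := by
  obtain ⟨CQ, k, hCQ, hQ⟩ := oddSym_invPhi_bounds
  -- `4πG` by scaling the package of `G`
  have h4G := oddSym_const_mul_bounds contDiff_gaussVortexProfile (4 * Real.pi) oddSym_gauss_bounds
  have h4π : |(4 * Real.pi : ℝ)| = 4 * Real.pi := abs_of_pos (by positivity)
  simp only [h4π] at h4G
  have hθ := oddSym_mul_bounds (f := fun y => 4 * Real.pi * gaussVortexProfile y)
    (v := fun y : EuclideanSpace ℝ (Fin 2) => (burgersPhi (‖y‖ ^ 2 / 4))⁻¹)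
    (a := fun x => (4 * Real.pi) * ((1 + ‖x‖) ^ 2 * gaussVortexProfile x))
    (b := fun x => CQ * (1 + ‖x‖) ^ k)
    (contDiff_const.mul contDiff_gaussVortexProfile)
    (contDiff_inv_burgersPhi.comp ((contDiff_norm_sq ℝ).div_const _)) h4G hQ
  rw [oddSym_theta_eq]
  refine ⟨4 * ((4 * Real.pi) * (4 * Real.pi)⁻¹) * CQ, k + 2, by positivity, fun x => ?_⟩
  have key : 4 * ((4 * Real.pi * ((1 + ‖x‖) ^ 2 * gaussVortexProfile x)) * (CQ * (1 + ‖x‖) ^ k)) =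
      4 * ((4 * Real.pi) * (4 * Real.pi)⁻¹) * CQ * (1 + ‖x‖) ^ (k + 2) * Real.exp (-(‖x‖ ^ 2 / 4)) := by
    rw [gaussVortexProfile, pow_add]; ring
  rw [← key, kerWeight_norm_eq, div_eq_mul_inv]
  exact hθ x

/-- `Φ(|x|) = F(|x|²/4)` with `F(t) = e^{−t}/φ(t)`. [folklore] -/
theorem oddSym_theta_eq_comp : (fun x : EuclideanSpace ℝ (Fin 2) => kerWeight ‖x‖) =
    (fun t : ℝ => Real.exp (-t) / burgersPhi t) ∘ fun x : EuclideanSpace ℝ (Fin 2) => ‖x‖ ^ 2 / 4 := by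
  funext x
  simp only [comp_apply, kerWeight]

/-- **The derivative of the kernel weight is radial**: `D(Φ(|·|))(x)[v] = 0` whenever `⟪x, v⟫ = 0`
(chain rule through `|x|²/4`). [folklore] -/
theorem oddSym_fderiv_theta_eq_zero {x v : EuclideanSpace ℝ (Fin 2)} (hv : ⟪x, v⟫_ℝ = 0) :
    fderiv ℝ (fun y : EuclideanSpace ℝ (Fin 2) => kerWeight ‖y‖) x v = 0 := by
  have hF : DifferentiableAt ℝ (fun t : ℝ => Real.exp (-t) / burgersPhi t) (‖x‖ ^ 2 / 4) :=
    ((Real.differentiable_exp.comp differentiable_neg).div (contDiff_burgersPhi (n := 1)).differentiable_one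
      fun t => (burgersPhi_pos t).ne') _
  have h := hF.hasDerivAt.comp_hasFDerivAt x (hasFDerivAt_norm_sq_div_four x)
  rw [oddSym_theta_eq_comp, h.fderiv, FunLike.coe_smul, Pi.smul_apply,
    FunLike.coe_smul, Pi.smul_apply, innerSL_apply_apply, hv, smul_zero, smul_zero]

/-- **`Φ Ω = G/2`**: `kerWeight ‖x‖ · (8π)⁻¹ φ(|x|²/4) = G(x)/2`. [folklore] -/
theorem oddSym_theta_mul_omega (x : EuclideanSpace ℝ (Fin 2)) :
    kerWeight ‖x‖ * ((8 * Real.pi)⁻¹ * burgersPhi (‖x‖ ^ 2 / 4)) = gaussVortexProfile x / 2 := by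
  rw [kerWeight_norm_eq]
  have hφ := (burgersPhi_pos (‖x‖ ^ 2 / 4)).ne'
  have hπ : Real.pi ≠ 0 := Real.pi_pos.ne'
  field_simp
  ring

/-! ### Weighted integrability of Gaussian-class functions -/

/-- **`G_λ⁻¹ X² ∈ L¹`** for a measurable `X` of Gaussian class `|X| ≤ C(1+|x|)^N e^{−|x|²/4}` and
`λ ∈ [0,1)` (`G_λ⁻¹ G ≤ (1−λ)⁻¹`, Gaussian moments). [folklore] -/
theorem oddSym_integrable_inv_gaussWeightLam_mul_sq {lam : ℝ} (hlam : lam ∈ Set.Ico (0 : ℝ) 1)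
    {X : EuclideanSpace ℝ (Fin 2) → ℝ} {C : ℝ} {N : ℕ} (hXm : AEStronglyMeasurable X volume)
    (hX : ∀ x, |X x| ≤ C * (1 + ‖x‖) ^ N * Real.exp (-(‖x‖ ^ 2 / 4))) :
    Integrable (fun x => (gaussWeightLam lam x)⁻¹ * X x ^ 2) := by
  have hl1 : lam < 1 := hlam.2
  have hmaj : Integrable fun x : EuclideanSpace ℝ (Fin 2) =>
      (C * (4 * Real.pi)) ^ 2 * (1 - lam)⁻¹ * ((1 + ‖x‖) ^ (2 * N) * gaussVortexProfile x) :=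
    (integrable_one_add_norm_pow_mul_gaussVortexProfile (2 * N)).const_mul _
  refine hmaj.mono' ((continuous_inv_gaussWeightLam hl1).aestronglyMeasurable.mul (hXm.pow 2))
    (Eventually.of_forall fun x => ?_)
  have hg0 : 0 ≤ (gaussWeightLam lam x)⁻¹ := (inv_pos.2 (gaussWeightLam_pos hl1 x)).le
  have hG := gaussVortexProfile_pos x
  have hGG := inv_gaussWeightLam_mul_gaussVortexProfile_le hlam x
  rw [Real.norm_of_nonneg (mul_nonneg hg0 (sq_nonneg _))]
  have hexp : Real.exp (-(‖x‖ ^ 2 / 4)) = 4 * Real.pi * gaussVortexProfile x := by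
    rw [gaussVortexProfile]; field_simp
  have h1 : |X x| ≤ C * (4 * Real.pi) * (1 + ‖x‖) ^ N * gaussVortexProfile x := by
    have := hX x; rw [hexp] at this; linarith
  have h2 : X x ^ 2 ≤ (C * (4 * Real.pi) * (1 + ‖x‖) ^ N * gaussVortexProfile x) ^ 2 := by
    rw [← sq_abs]; exact pow_le_pow_left₀ (abs_nonneg _) h1 2
  calc (gaussWeightLam lam x)⁻¹ * X x ^ 2
      ≤ (gaussWeightLam lam x)⁻¹ * (C * (4 * Real.pi) * (1 + ‖x‖) ^ N * gaussVortexProfile x) ^ 2 :=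
        mul_le_mul_of_nonneg_left h2 hg0
    _ = (C * (4 * Real.pi)) ^ 2 * ((gaussWeightLam lam x)⁻¹ * gaussVortexProfile x) *
          ((1 + ‖x‖) ^ (2 * N) * gaussVortexProfile x) := by rw [pow_mul']; ring
    _ ≤ (C * (4 * Real.pi)) ^ 2 * (1 - lam)⁻¹ * ((1 + ‖x‖) ^ (2 * N) * gaussVortexProfile x) := by
        have h3 : 0 ≤ (1 + ‖x‖) ^ (2 * N) * gaussVortexProfile x := by positivity
        have h4 : 0 ≤ (C * (4 * Real.pi)) ^ 2 := sq_nonneg _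
        calc _ = (C * (4 * Real.pi)) ^ 2 * (((gaussWeightLam lam x)⁻¹ * gaussVortexProfile x) *
              ((1 + ‖x‖) ^ (2 * N) * gaussVortexProfile x)) := by ring
          _ ≤ (C * (4 * Real.pi)) ^ 2 * ((1 - lam)⁻¹ * ((1 + ‖x‖) ^ (2 * N) * gaussVortexProfile x)) :=
              mul_le_mul_of_nonneg_left (mul_le_mul_of_nonneg_right hGG h3) h4
          _ = _ := by ring

/-- **Sub-stub `stub_oddSymmetrizerBoundsToolsB` of crux stmt-NavierStokesRegularity-17973, line
`Sketch`** (tools for `stub_oddSymmetrizerBounds`): second-order Gaussian class of the kernel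
weight `x ↦ Φ(|x|)`, radial derivative, `ΦΩ = G/2`, and `G_λ⁻¹X² ∈ L¹` for Gaussian-class `X`. [folklore] -/
theorem stub_oddSymmetrizerBoundsToolsB :
    (∃ (C : ℝ) (N : ℕ), 0 ≤ C ∧ ∀ x : EuclideanSpace ℝ (Fin 2),
      |kerWeight ‖x‖| ≤ C * (1 + ‖x‖) ^ N * Real.exp (-(‖x‖ ^ 2 / 4)) ∧
      ‖fderiv ℝ (fun y : EuclideanSpace ℝ (Fin 2) => kerWeight ‖y‖) x‖ ≤ C * (1 + ‖x‖) ^ N * Real.exp (-(‖x‖ ^ 2 / 4)) ∧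
      ‖fderiv ℝ (fderiv ℝ (fun y : EuclideanSpace ℝ (Fin 2) => kerWeight ‖y‖)) x‖ ≤
        C * (1 + ‖x‖) ^ N * Real.exp (-(‖x‖ ^ 2 / 4))) ∧
    (∀ x v : EuclideanSpace ℝ (Fin 2), ⟪x, v⟫_ℝ = 0 →
      fderiv ℝ (fun y : EuclideanSpace ℝ (Fin 2) => kerWeight ‖y‖) x v = 0) ∧
    (∀ x : EuclideanSpace ℝ (Fin 2),
      kerWeight ‖x‖ * ((8 * Real.pi)⁻¹ * burgersPhi (‖x‖ ^ 2 / 4)) = gaussVortexProfile x / 2) ∧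
    (∀ lam ∈ Set.Ico (0 : ℝ) 1, ∀ (X : EuclideanSpace ℝ (Fin 2) → ℝ) (C : ℝ) (N : ℕ),
      AEStronglyMeasurable X volume → (∀ x, |X x| ≤ C * (1 + ‖x‖) ^ N * Real.exp (-(‖x‖ ^ 2 / 4))) →
      Integrable (fun x => (gaussWeightLam lam x)⁻¹ * X x ^ 2)) :=
  ⟨oddSym_theta_bounds, fun _ _ hv => oddSym_fderiv_theta_eq_zero hv, oddSym_theta_mul_omega,
    fun _ hlam _ _ _ hXm hX => oddSym_integrable_inv_gaussWeightLam_mul_sq hlam hXm hX⟩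

end Summit.NavierStokesRegularity.NavierStokesRegularity.Theorems
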